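import Summits.QuantumFields.YangMills.Theorems.BalabanUVNodesN15SiteCurvedKnitMassless
import Summits.QuantumFields.YangMills.Theorems.BalabanUVNodesN15KingModelCurvedKnitFieldClosed
import Summits.QuantumFields.YangMills.Theorems.BalabanUVNodesN15CurvedDressedPairExp
import HarnessLib

/-!
# Route «BalabanUVNodes», cluster K4 «SpineRates» — node N15 = NE2: THE SITE LAYER WITH THE BACKGROUND LIVE IN THE TwoGrid ENTRY CURRENCY, XXXI — THE CURVED-DRESSED LAYER's
# SIZES AND BACKGROUND-LIPSCHITZ INCREMENTS: King's propagator `⊗ 1` on the CLOSED mass range (incl. the MASSLESS site propagator `G′ ⊗ 1`) dressed by the genuine adjoint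
# transporters `Ad(e^{η′A′(x)})` of a small, slowly varying `𝔲(N)` field — `pr₀X̂ ≤ B·e^{−(δ∕2)d}` on both grids and `pr₀X̂ − G ≤ E·t·e^{−(δ∕2)d}` LINEAR in the field's small-field bound `t`
# (four of part XXII's six dressed letters, for the exact-transporter edition of this seat's coloured site layer)

Cell `pub-ymgap`, WIDTH SEAT `pub-ymgap-dag-n15-w1` (generation 4; director-ym №197 ∕ HUMAN RULING D-0149; chair R455 (A) ∕ R461; dag-lead KEY MAP v2 INBOX l.35754; sequel (2) of CLAIM-1
l.37310, CLAIM-2 l.37613).  `bears_on: R4∕N15 · K3⁸ SpineGivenEndpointR13SepCoPHV (stmt-QuantumFields-27366; K3⁷ 20544 aside = lineage)`.  Filed `--kind proof --supports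
stmt-QuantumFields-27366 --as helper` — COUNT-NEUTRAL.  THEOREMS ONLY (0 `def`, 0 `sorry`).  Imports BY NAME this seat's part XXX `…N15SiteCurvedKnitMassless` (`kingFullProp_layer_backward_massRange`:
the nine letters on `0 ≤ m² ≤ m₀²`), dag-n15-w2's `…KingModelCurvedKnitFieldClosed` (p608614: `expRowLetter_field_le`; p599926 `basisConst_le_sqrt_card_of_traceForm`) and dag-n15-w2's p594747
`…CurvedDressedPairExp` (`hasMaj_curvDressed_exp_of_skew`, `hasMaj_curvDressed_sub_exp_of_skew` = dag-n15-w3 file 2's size ∕ increment at exponential data, orthogonality supplied);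
dag-n15-w3 file 10's `blockMeanField`, `norm_blockMeanTV_le`, `gradLetter_blockMean`, `blockMeanTV_skew`, n15-b's `hasMaj_projO_comp`, dag-n15-e's Ω-b dictionary
(`covPieces_flat_*`, `castT`, `blockOf_comp_blockOf_eq`, `hasMaj_conjEquiv`); nothing in the tree is modified.

WHY.  Part XXII `siteLettersC_of_sizedDressedLetters` feeds part XXI's coloured site socket from SIX block letters of a dressed coloured layer `X` over its `U ≡ 1` layer `G`: sizes of `X`
on both grids, increments `X − G ≤ ε·s·e^{−δd}` LINEAR in the window's smallness `s`, and the two-grid defect.  For the EXACT-TRANSPORTER edition the dressed layer is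
`X = pr₀ ∘ curvDressed` (dag-n15-w3's pair-space object, [Balaban1985BackgroundPropagators] (3.53)∕(3.63)–(3.65) in transporter form) of King's propagator `⊗ 1` dressed by
`e^{η ad A} = Ad(e^{ηA})`.  THIS FILE supplies the four size ∕ increment letters at every mass `0 ≤ m² ≤ m₀²` (the site layer takes `m² = 0`): p594747's size and increment theorems fed
part XXX's nine letters (read through `tensorId` ∕ `castT` exactly as in Ω-c), with the Neumann smallness `β·R_V·c_r ≤ ½` DISCHARGED for `t ≤ t₀ = min ½ (1∕(2D))` through the row
letter's linear bound `R_V(2t, 0, 2t) ≤ 2t·S` (`expRowLetter_field_le`) — so the increment constant is `≤ (4β²Sc_dc_r + 1)·t`, linear in the potential's bound as (3.35)'s «Mα₀» enters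
Thm 3.4.  The defect letter (sixth) is part XXXII.

CONTENTS.  §1 ★★ `uN_curvDressed_sizes_massRange_coarse` — coarse run `Tor (fine (L^K) M)`, King blocks `blockOf (L^K)`, `G = kingGT`, generator `ad Ā′` (block mean of the fine
potential), `η = L·η′`: `∃ δ B E t₀ > 0`, for every `K ≥ 1`, cube `2L^e`, `0 ≤ m² ≤ m₀²`, `Msz`, `0 ≤ t ≤ t₀`, skew-Hermitian `A′` with `‖A′‖ ≤ t`, `‖A′(y′) − A′(y′ − e_ν)‖ ≤ η′t`:
`pr₀X̂ ≤ B·e^{−(δ∕2)d}` and `pr₀X̂ − G ≤ E·t·e^{−(δ∕2)d}`.  §2 ★★ `uN_curvDressed_sizes_massRange_fine` — the same on the fine run `Tor (fine L (fine (L^K) M))` (blocks `∘ blockOf L`,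
`G′ = kingGT₁`, generator `ad A′`, `η′`).

HONEST FRAMING ∕ LIMITS.  Count-neutral; bookkeeping over LANDED theorems (two instantiations + arithmetic); no new analytic estimate.  King's `A = 0` MODEL propagator at the FLAT base
point dressed by the exact adjoint transporter of a small potential (coarse potential = block mean — the lineage's model of the averaging, not Bałaban's (3.8)); ONE blocking step; NOT
Bałaban's `G(U)` at a (3.35)-regular `U` of the datum; nothing of [B5]∕[B6]∕[B9] asserted ((3.35)–(3.37) p. 396, (3.50) p. 400, Thm 3.1 (3.42) p. 397, Thm 3.4 p. 400, (3.63)–(3.65)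
pp. 402–403 = SHAPES ∕ MECHANISM; [King1986] (4.1)–(4.5) p. 670 = TEMPLATE).  NE2⁺ NOT PRINTED ∕ NOT proved for d = 4; **N15 is NOT discharged**; K3⁸ OPEN, not claimed, skeleton v6
untouched; counts of record UNMOVED (typed 28∕28 · discharged 5∕27, A 5∕28); no summit statement is proved here; one finite four-torus programme at fixed `ε` — NOT ℝ⁴, NOT infinite
volume, NOT OS, NOT a mass gap, NOT Clay; R4 closes the conditional finite-𝕋⁴ rung `BalabanLadder.UV` only.  Restate-immune (no Theses import).
-/

set_option autoImplicit false

noncomputable section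
open scoped BigOperators Matrix Matrix.Norms.Frobenius Topology

namespace Summit.QuantumFields.YangMills.BalabanUVNodes.N15.SiteLayerBg

open Real Finset NormedSpace Filter
open Literature.MathematicalPhysics.QuantumFieldTheory.Balaban1983to89
open Literature.MathematicalPhysics.QuantumFieldTheory.Balaban1983to89.B11SectG (BlockNorm HasMaj RowSum)
open Literature.MathematicalPhysics.QuantumFieldTheory.Balaban1983to89.B6RandomWalk (Triangle254)
open Literature.MathematicalPhysics.QuantumFieldTheory.Balaban1983to89.B6UnitTorusCarrier (unitTorusGeo triangle254_unitTorusGeo rowSum_unitTorusGeo)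
open Literature.MathematicalPhysics.QuantumFieldTheory.Balaban1983to89.T4EtaRateDefect (idef idef_apply idef_comp)
open Literature.MathematicalPhysics.QuantumFieldTheory.Balaban1983to89.T4EtaRateCoeffDefect (pull pull_apply)
open Literature.MathematicalPhysics.QuantumFieldTheory.Balaban1983to89.B5Prop11Plancherel (Tor fine unitVec)
open Literature.MathematicalPhysics.QuantumFieldTheory.King1986 (aK aK_pos)
open Literature.MathematicalPhysics.QuantumFieldTheory.King1986.Torus (fineOp blockOf tdistT tdistT_nonneg)
open Literature.MathematicalPhysics.QuantumFieldTheory.Balaban1983to89.Beta.AveragingCorrectionJets (adCLM norm_adCLM_le adCLM_smul)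
open Literature.Barriers.QuantumFields (traceForm)
open Summit.QuantumFields.YangMills.BalabanUVNodes.N15.VectorPiece (unitTorusGeoS tensorId tensorId_apply hasMaj_tensorId idef_tensorId)
open Summit.QuantumFields.YangMills.BalabanUVNodes.N15.MatrixSpecies (liftMap liftBlk liftEquiv liftEquiv_apply liftEquiv_symm_apply coordMat coordMat_sub basisConst
  basisConst_nonneg Phi0 adCLM_sub)
open Summit.QuantumFields.YangMills.BalabanUVNodes.N15.BackgroundLayer (fgrad bgrad liftPair blkPair projO coordMat_smul coordMat_one hasMaj_projO_comp)
open Summit.QuantumFields.YangMills.BalabanUVNodes.N15.CurvedSpecies (torStep blockMeanField blockMeanTV covPieces covPieces_one gaugePair gaugePair_one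
  curvDressed expTrField expTrField_apply expRowLetter expFitLetter curvRowLetter torStep_symm_apply coordMat_adCLM_transpose_eq_neg_of_conjTranspose
  expRowLetter_nonneg expRowLetter_field_le expRowLetter_field_eq expFitLetter_field_le expFitLetter_field_eq knitFieldConst_le basisConst_le_sqrt_card_of_traceForm
  norm_blockMeanTV_le gradLetter_blockMean blockMeanTV_skew hasMaj_curvDressed_exp_of_skew hasMaj_curvDressed_sub_exp_of_skew)
open Summit.QuantumFields.YangMills.BalabanUVNodes.N15KingModelRung.Curved

variable {d : ℕ} (L : ℕ) [NeZero L]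
variable {n : Type} [Fintype n] [DecidableEq n] {κ : Type} [Fintype κ] [DecidableEq κ] (e : Matrix n n ℂ ≃L[ℝ] (κ → ℝ))

/-! ## ★★ Sizes and background-Lipschitz increments of the curved-dressed layer on the closed mass range — §1 coarse grid, §2 fine grid -/

section Sizes

omit [DecidableEq κ] in
/-- THE SMALL-FIELD BOOKKEEPING (pure arithmetic; dag-n15-w2's `expRowLetter_field_le` + `κ_e ≤ √|κ|`): with the row slope `S`, `D = 4β(S c_d)c_r + 1` and `t ≤ min ½ (1∕(2D))`,
the file-2 row letter `R = R_V(2t, 0, 2t)·c_d` satisfies `2t ≤ 1`, `βRc_r < 1`, `β(1 − βRc_r)⁻¹ ≤ 2β`, `β·(R·β(1 − βRc_r)⁻¹)·c_r ≤ (4β²(S c_d)c_r + 1)·t`. [folklore] -/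
theorem smallField_rowLetter (he : ∀ X Y : Matrix n n ℂ, traceForm X Y = e X ⬝ᵥ e Y) {β c S D t R : ℝ} (hβ : 0 < β) (hc : 0 ≤ c)
    (hS_def : S = Real.sqrt (Fintype.card κ) * Real.exp 1 * ((Fintype.card κ : ℝ) + (Fintype.card κ : ℝ) ^ 3) +
      (Fintype.card κ : ℝ) * ((Fintype.card (Fin (d + 1)) : ℝ) * ((Fintype.card κ : ℝ) * (Real.sqrt (Fintype.card κ) * Real.exp 1) ^ 2 + Real.sqrt (Fintype.card κ) * Real.exp 1)))
    (hD_def : D = 4 * β * (S * (1 + Fintype.card (Fin (d + 1) ⊕ Fin (d + 1)))) * c + 1) (ht0 : 0 ≤ t) (htt₀ : t ≤ min (1 / 2) (1 / (2 * D)))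
    (hR_def : R = curvRowLetter κ (Fin (d + 1)) (basisConst e * Real.exp 1 * (2 * t))
      (basisConst e * (Real.exp 1 * (2 * t) + Real.exp 1 ^ 2 * (2 + Real.exp 1) * (2 * t) * 0)) * (1 + Fintype.card (Fin (d + 1) ⊕ Fin (d + 1)))) :
    2 * t ≤ 1 ∧ β * R * c < 1 ∧ β * (1 - β * R * c)⁻¹ ≤ 2 * β ∧
      β * (R * (β * (1 - β * R * c)⁻¹)) * c ≤ (4 * β ^ 2 * (S * (1 + Fintype.card (Fin (d + 1) ⊕ Fin (d + 1)))) * c + 1) * t := by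
  have hcd : (0 : ℝ) ≤ 1 + Fintype.card (Fin (d + 1) ⊕ Fin (d + 1)) := by positivity
  have hκ0 : 0 ≤ basisConst e := basisConst_nonneg e
  have hκs : basisConst e ≤ Real.sqrt (Fintype.card κ) := basisConst_le_sqrt_card_of_traceForm e he
  have hS : 0 ≤ S := by rw [hS_def]; positivity
  have hD : 0 < D := by rw [hD_def]; positivity
  have ht1 : 2 * t ≤ 1 := by have h := htt₀.trans (min_le_left (1 / 2 : ℝ) (1 / (2 * D))); linarith
  have htD : 2 * t ≤ 1 / D := by
    have h := htt₀.trans (min_le_right (1 / 2 : ℝ) (1 / (2 * D)))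
    have e1 : 2 * (1 / (2 * D)) = 1 / D := by field_simp
    linarith
  have h2t : 0 ≤ 2 * t := by positivity
  have hRt : R ≤ 2 * t * (S * (1 + Fintype.card (Fin (d + 1) ⊕ Fin (d + 1)))) := by
    have h1 := expRowLetter_field_le κ (Fin (d + 1)) hκ0 hκs h2t ht1
    unfold expRowLetter at h1
    have h2 := mul_le_mul_of_nonneg_right h1 hcd
    rw [hR_def, hS_def]
    linarith
  have hT : 0 ≤ S * (1 + Fintype.card (Fin (d + 1) ⊕ Fin (d + 1))) := mul_nonneg hS hcd
  have hq2 : β * R * c ≤ 1 / 2 := by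
    have h1 : β * R * c ≤ β * (1 / D * (S * (1 + Fintype.card (Fin (d + 1) ⊕ Fin (d + 1))))) * c :=
      mul_le_mul_of_nonneg_right (mul_le_mul_of_nonneg_left (hRt.trans (mul_le_mul_of_nonneg_right htD hT)) hβ.le) hc
    have h2' : β * (1 / D * (S * (1 + Fintype.card (Fin (d + 1) ⊕ Fin (d + 1))))) * c = (β * (S * (1 + Fintype.card (Fin (d + 1) ⊕ Fin (d + 1)))) * c) / D := by ring
    have h3 : (β * (S * (1 + Fintype.card (Fin (d + 1) ⊕ Fin (d + 1)))) * c) / D ≤ 1 / 2 := by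
      rw [div_le_iff₀ hD, hD_def]; nlinarith [mul_nonneg (mul_nonneg hβ.le hT) hc]
    linarith
  have hinv : (1 - β * R * c)⁻¹ ≤ 2 := by rw [inv_le_comm₀ (by linarith) (by norm_num : (0 : ℝ) < 2)]; linarith
  have hinv0 : 0 ≤ (1 - β * R * c)⁻¹ := inv_nonneg.mpr (by linarith)
  refine ⟨ht1, by linarith, by have h1 := mul_le_mul_of_nonneg_left hinv hβ.le; linarith, ?_⟩
  have h1 : β * (R * (β * (1 - β * R * c)⁻¹)) * c = (β * β * c) * (R * (1 - β * R * c)⁻¹) := by ring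
  have h2' : R * (1 - β * R * c)⁻¹ ≤ (2 * t * (S * (1 + Fintype.card (Fin (d + 1) ⊕ Fin (d + 1))))) * 2 := mul_le_mul hRt hinv hinv0 (by positivity)
  have h3 := mul_le_mul_of_nonneg_left h2' (show 0 ≤ β * β * c by positivity)
  rw [h1]
  refine h3.trans ?_
  have h4 : β * β * c * (2 * t * (S * (1 + Fintype.card (Fin (d + 1) ⊕ Fin (d + 1)))) * 2) = (4 * β ^ 2 * (S * (1 + Fintype.card (Fin (d + 1) ⊕ Fin (d + 1)))) * c) * t := by ring
  rw [h4]
  have h5 : 4 * β ^ 2 * (S * (1 + Fintype.card (Fin (d + 1) ⊕ Fin (d + 1)))) * c ≤ 4 * β ^ 2 * (S * (1 + Fintype.card (Fin (d + 1) ⊕ Fin (d + 1)))) * c + 1 := by linarith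
  exact mul_le_mul_of_nonneg_right h5 ht0

/-- ★★ **THE CURVED-DRESSED LAYER's SIZES AND INCREMENTS, LINEAR IN THE SMALL FIELD.**  For odd `L ≥ 3`, `a > 0`, `m₀² ≥ 0` and trace-form-orthonormal coordinates `e` of `M_N(ℂ)` there are
`δ, B, E, t₀ > 0` such that for every `K ≥ 1`, cube `2L^e`, mass `0 ≤ m² ≤ m₀²`, size datum `Msz`, every `0 ≤ t ≤ t₀` and every skew-Hermitian `A′` on the fine torus with `‖A′_μ(y′)‖ ≤ t`,
`‖A′_μ(y′) − A′_μ(y′ − e_ν)‖ ≤ η′t` (`η′ = L^{−(K+1)}`): the `none` components `pr₀X̂` of dag-n15-w3's curved dressed pairs of King's propagator `⊗ 1` — coarse run dressed by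
`e^{η ad Ā′}` (block mean, `η = Lη′`), fine run by `e^{η′ ad A′} = Ad(e^{η′A′})`, flat base point — satisfy `pr₀X̂ ≤ B·e^{−(δ∕2)|y−y′|_T}` on King's blocks (`blockOf (L^K)`, resp.
`∘ blockOf L`) and the background-Lipschitz increments `pr₀X̂ − G ≤ E·t·e^{−(δ∕2)|y−y′|_T}` (`G = kingGT`, `G′ = kingGT₁`) — dag-n15-w3 file 2's `hasMaj_curvDressed(_sub)` at exponential data
(p594747) on part XXX's nine letters; smallness `β·R_V·c_r ≤ ½` from `R_V(2t, 0, 2t) ≤ 2t·S` for `t ≤ t₀ = min ½ (1∕(2D))`; `B = 2β`, `E = 4β²Sc_dc_r + 1`.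
[cite: Balaban1985BackgroundPropagators, (3.35) p.396 («Mα₀»: the linear smallness), Thm 3.4 p.400, (3.63)–(3.65) pp.402–403 (mechanism); King1986, (4.1)–(4.5) p.670; Balaban1984PropagatorsI, p.25] -/
theorem uN_curvDressed_sizes_massRange_coarse (he : ∀ X Y : Matrix n n ℂ, traceForm X Y = e X ⬝ᵥ e Y) (hLodd : Odd L) (hL : 2 ≤ L) {a : ℝ} (ha : 0 < a)
    {m0sq : ℝ} (hm0 : 0 ≤ m0sq) :
    ∃ δ B E t₀ : ℝ, 0 < δ ∧ 0 < B ∧ 0 < E ∧ 0 < t₀ ∧ ∀ (K : ℕ), 1 ≤ K → ∀ (ex : ℕ) (M : Fin (d + 1) → ℕ) [∀ μ, NeZero (M μ)], (∀ μ, M μ = 2 * L ^ ex) →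
      ∀ (msq : ℝ), 0 ≤ msq → msq ≤ m0sq → ∀ (Msz : ℝ) (A' : Fin (d + 1) → Tor (fine L (fine (L ^ K) M)) → Matrix n n ℂ) (t : ℝ), 0 ≤ t → t ≤ t₀ →
      (∀ μ y', ‖A' μ y'‖ ≤ t) →
      (∀ μ ν y', ‖A' μ y' - A' μ (y' - unitVec (fine L (fine (L ^ K) M)) ν)‖ ≤ ((L : ℝ) ^ (K + 1))⁻¹ * t) →
      (∀ μ y', (A' μ y')ᴴ = -A' μ y') →
    HasMaj (BlockNorm.ofBlocks (unitTorusGeoS L K M Msz) (liftBlk (blockOf (L ^ K) M) κ)) (BlockNorm.ofBlocks (unitTorusGeoS L K M Msz) (liftBlk (blockOf (L ^ K) M) κ))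
        (projO (none : Option (Fin (d + 1) ⊕ Fin (d + 1))) ∘ₗ
          curvDressed ((L : ℝ) * ((L : ℝ) ^ (K + 1))⁻¹) (torStep (fine (L ^ K) M)) (expTrField e ((L : ℝ) * ((L : ℝ) ^ (K + 1))⁻¹) (blockMeanField L (fine (L ^ K) M) 0))
            (expTrField e ((L : ℝ) * ((L : ℝ) ^ (K + 1))⁻¹) (blockMeanField L (fine (L ^ K) M) (fun μ y' => adCLM ℝ (A' μ y')))) (kingGT L a msq K M κ))
        (fun y y' => B * Real.exp (-(δ / 2 * tdistT M y y'))) ∧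
      HasMaj (BlockNorm.ofBlocks (unitTorusGeoS L K M Msz) (liftBlk (blockOf (L ^ K) M) κ)) (BlockNorm.ofBlocks (unitTorusGeoS L K M Msz) (liftBlk (blockOf (L ^ K) M) κ))
        (projO (none : Option (Fin (d + 1) ⊕ Fin (d + 1))) ∘ₗ
          curvDressed ((L : ℝ) * ((L : ℝ) ^ (K + 1))⁻¹) (torStep (fine (L ^ K) M)) (expTrField e ((L : ℝ) * ((L : ℝ) ^ (K + 1))⁻¹) (blockMeanField L (fine (L ^ K) M) 0))
            (expTrField e ((L : ℝ) * ((L : ℝ) ^ (K + 1))⁻¹) (blockMeanField L (fine (L ^ K) M) (fun μ y' => adCLM ℝ (A' μ y')))) (kingGT L a msq K M κ) - kingGT L a msq K M κ)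
        (fun y y' => E * t * Real.exp (-(δ / 2 * tdistT M y y'))) := by
  obtain ⟨β, δ, m, hβ, hδ, hm, H⟩ := kingFullProp_layer_backward_massRange (d := d) L hLodd hL ha hm0 (γ := 1 / 2) (by norm_num) (by norm_num) (α := 1 / 2) (by norm_num) (by norm_num)
  -- level-independent letters: `c_r`, the row slope `S`, `D = 4β(S c_d)c_r + 1`, `t₀ = min ½ (1∕(2D))`
  have hc : 0 ≤ B4Sect5Proof.latticeConst (d + 1) (δ / 2) := B4Sect5Proof.latticeConst_nonneg (d + 1) (half_pos hδ).le
  obtain ⟨S, hS_def⟩ : ∃ S : ℝ, S = Real.sqrt (Fintype.card κ) * Real.exp 1 * ((Fintype.card κ : ℝ) + (Fintype.card κ : ℝ) ^ 3) +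
      (Fintype.card κ : ℝ) * ((Fintype.card (Fin (d + 1)) : ℝ) * ((Fintype.card κ : ℝ) * (Real.sqrt (Fintype.card κ) * Real.exp 1) ^ 2 + Real.sqrt (Fintype.card κ) * Real.exp 1)) := ⟨_, rfl⟩
  have hS : 0 ≤ S := by rw [hS_def]; positivity
  obtain ⟨D, hD_def⟩ : ∃ D : ℝ, D = 4 * β * (S * (1 + Fintype.card (Fin (d + 1) ⊕ Fin (d + 1)))) * B4Sect5Proof.latticeConst (d + 1) (δ / 2) + 1 := ⟨_, rfl⟩
  have hD : 0 < D := by rw [hD_def]; positivity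
  refine ⟨δ, 2 * β, 4 * β ^ 2 * (S * (1 + Fintype.card (Fin (d + 1) ⊕ Fin (d + 1)))) * B4Sect5Proof.latticeConst (d + 1) (δ / 2) + 1, min (1 / 2) (1 / (2 * D)), hδ,
    by positivity, by positivity, lt_min (by norm_num) (by positivity), fun K hK ex M _ hM msq hmsq hcap Msz A' t ht0 htt₀ hA hgradA hAs => ?_⟩
  -- the small field: `2t ≤ 1`, the Neumann smallness, and the two constants of the conclusions (pure arithmetic)
  obtain ⟨ht1, hq', hBle, hEle⟩ := smallField_rowLetter (d := d) e he (c := B4Sect5Proof.latticeConst (d + 1) (δ / 2)) hβ hc hS_def hD_def ht0 htt₀ rfl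
  have h2t : 0 ≤ 2 * t := by positivity
  -- carrier facts of the level
  have hL1 : (1 : ℝ) ≤ (L : ℝ) := by exact_mod_cast (show 1 ≤ L by omega)
  have hL0 : (0 : ℝ) < (L : ℝ) := by positivity
  have hη' : 0 < ((L : ℝ) ^ (K + 1))⁻¹ := by positivity
  have hη : 0 < (L : ℝ) * ((L : ℝ) ^ (K + 1))⁻¹ := mul_pos hL0 hη'
  have hηle : (L : ℝ) * ((L : ℝ) ^ (K + 1))⁻¹ ≤ 1 := by
    rw [pow_succ', mul_inv, ← mul_assoc, mul_inv_cancel₀ hL0.ne', one_mul]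
    exact inv_le_one_of_one_le₀ (one_le_pow₀ hL1)
  have hη'le : ((L : ℝ) ^ (K + 1))⁻¹ ≤ 1 := inv_le_one_of_one_le₀ (one_le_pow₀ hL1)
  have hreg : (L : ℝ) * ((L : ℝ) ^ (K + 1))⁻¹ * (2 * t) ≤ 1 := by nlinarith
  have hreg' : ((L : ℝ) ^ (K + 1))⁻¹ * (2 * t) ≤ 1 := by nlinarith
  have hregB : (L : ℝ) * ((L : ℝ) ^ (K + 1))⁻¹ * 0 ≤ 1 := by simp
  have hregB' : ((L : ℝ) ^ (K + 1))⁻¹ * 0 ≤ 1 := by simp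
  have hσ : 0 < δ / 2 := half_pos hδ
  have htri : Triangle254 (unitTorusGeoS L K M Msz) := triangle254_unitTorusGeo L K M
  have hd : ∀ a b : (unitTorusGeoS L K M Msz).Site, 0 ≤ (unitTorusGeoS L K M Msz).dist a b := fun a b => tdistT_nonneg M a b
  have hrow : RowSum (unitTorusGeoS L K M Msz) (δ / 2) (B4Sect5Proof.latticeConst (d + 1) (δ / 2)) := rowSum_unitTorusGeo L K M hσ
  have hdist : ∀ y y' : Tor M, (unitTorusGeoS L K M Msz).dist y y' = tdistT M y y' := fun _ _ => rfl
  -- the nine scalar letters one level up (`n = 1`) at this mass, their majorants nonnegative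
  have HK := fun μ : Fin (d + 1) => H K hK 1 le_rfl ex M hM msq hmsq hcap Msz μ
  have maj0 : ∀ y y' : Tor M, 0 ≤ β * Real.exp (-(δ * tdistT M y y')) := fun _ _ => by positivity
  -- (hG) `G = A₀⁻¹ ⊗ 1`, (hD) its flat covariant pieces — coarse
  have hG : HasMaj (BlockNorm.ofBlocks (unitTorusGeoS L K M Msz) (liftBlk (blockOf (L ^ K) M) κ))
      (BlockNorm.ofBlocks (unitTorusGeoS L K M Msz) (liftBlk (blockOf (L ^ K) M) κ)) (kingGT L a msq K M κ)
      (fun y y' => β * Real.exp (-(δ * (unitTorusGeoS L K M Msz).dist y y'))) :=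
    hasMaj_tensorId κ maj0 (HK 0).1
  have hDc : ∀ j, HasMaj (BlockNorm.ofBlocks (unitTorusGeoS L K M Msz) (liftBlk (blockOf (L ^ K) M) κ))
      (BlockNorm.ofBlocks (unitTorusGeoS L K M Msz) (liftBlk (blockOf (L ^ K) M) κ))
      (covPieces ((L : ℝ) * ((L : ℝ) ^ (K + 1))⁻¹) (torStep (fine (L ^ K) M))
        (gaugePair (torStep (fine (L ^ K) M)) (expTrField e ((L : ℝ) * ((L : ℝ) ^ (K + 1))⁻¹) 0)) (kingGT L a msq K M κ) j)
      (fun y y' => β * Real.exp (-(δ * (unitTorusGeoS L K M Msz).dist y y'))) := by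
    intro j
    rw [expTrField_zero, gaugePair_one]
    cases j with
    | inl μ => rw [covPieces_flat_coarse_inl]; exact hasMaj_tensorId κ maj0 (HK μ).2.1
    | inr μ => rw [covPieces_flat_coarse_inr]; exact hasMaj_tensorId κ maj0 (HK μ).2.2.1
  -- generator letters READ OFF the potential: fine `Z′ = ad ∘ A′`, coarse `Z̄′` = block mean; `W = W′ = 0`
  have h2 : ∀ {X : Matrix n n ℂ} {c : ℝ}, ‖X‖ ≤ c → ‖adCLM ℝ X‖ ≤ 2 * c := fun hX => (norm_adCLM_le ℝ _).trans (mul_le_mul_of_nonneg_left hX two_pos.le)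
  have hZ' : ∀ μ y', ‖adCLM ℝ (A' μ y')‖ ≤ 2 * t := fun μ y' => h2 (hA μ y')
  have hgrad' : ∀ μ ν y', ‖adCLM ℝ (A' μ y') - adCLM ℝ (A' μ (y' - unitVec (fine L (fine (L ^ K) M)) ν))‖ ≤ ((L : ℝ) ^ (K + 1))⁻¹ * (2 * t) := fun μ ν y' => by
    rw [adCLM_sub, mul_left_comm]; exact h2 (hgradA μ ν y')
  have hZs' : ∀ μ y', (coordMat e (adCLM ℝ (A' μ y')))ᵀ = -coordMat e (adCLM ℝ (A' μ y')) := fun μ y' =>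
    coordMat_adCLM_transpose_eq_neg_of_conjTranspose e he (hAs μ y')
  have hZ : ∀ μ b, ‖blockMeanField L (fine (L ^ K) M) (fun μ y' => adCLM ℝ (A' μ y')) μ b‖ ≤ 2 * t := fun μ b =>
    norm_blockMeanTV_le L (fine (L ^ K) M) h2t fun j => hZ' μ _
  have hgrad : ∀ μ b, ‖blockMeanField L (fine (L ^ K) M) (fun μ y' => adCLM ℝ (A' μ y')) μ b -
      blockMeanField L (fine (L ^ K) M) (fun μ y' => adCLM ℝ (A' μ y')) μ ((torStep (fine (L ^ K) M) μ).symm b)‖ ≤ (L : ℝ) * ((L : ℝ) ^ (K + 1))⁻¹ * (2 * t) := fun μ b => by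
    rw [torStep_symm_apply]; exact gradLetter_blockMean L (fine (L ^ K) M) hη' h2t μ (hgrad' μ μ) b
  have hZs : ∀ μ b, (coordMat e (blockMeanField L (fine (L ^ K) M) (fun μ y' => adCLM ℝ (A' μ y')) μ b))ᵀ =
      -coordMat e (blockMeanField L (fine (L ^ K) M) (fun μ y' => adCLM ℝ (A' μ y')) μ b) := fun μ b => blockMeanTV_skew L (fine (L ^ K) M) e (hZs' μ) b
  refine ⟨?_, ?_⟩
  · -- coarse size
    rw [blockMeanField_zero]
    have hXc := hasMaj_curvDressed_exp_of_skew e ((L : ℝ) * ((L : ℝ) ^ (K + 1))⁻¹) (torStep (fine (L ^ K) M))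
      (blockMeanField L (fine (L ^ K) M) (fun μ y' => adCLM ℝ (A' μ y'))) 0 (blockOf (L ^ K) M) (kingGT L a msq K M κ)
      (g := unitTorusGeoS L K M Msz) (ρ := δ / 2) htri hd hrow hσ.le hσ.le (by linarith) hβ.le hη h2t le_rfl h2t hreg hregB hZ (fun _ _ => by rw [Pi.zero_apply, Pi.zero_apply, norm_zero]) hgrad hZs
      (fun _ _ => by
        have h00 := coordMat_sub e 0 0
        rw [sub_self, sub_self] at h00
        rw [Pi.zero_apply, Pi.zero_apply, h00, Matrix.transpose_zero, neg_zero]) hG hDc hq'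
    refine (hasMaj_projO_comp (g := unitTorusGeoS L K M Msz) (liftBlk (blockOf (L ^ K) M) κ) hXc none).mono fun y y' => ?_
    rw [hdist]
    exact mul_le_mul_of_nonneg_right hBle (Real.exp_nonneg _)
  · -- coarse increment
    rw [blockMeanField_zero]
    have hXc := hasMaj_curvDressed_sub_exp_of_skew e ((L : ℝ) * ((L : ℝ) ^ (K + 1))⁻¹) (torStep (fine (L ^ K) M))
      (blockMeanField L (fine (L ^ K) M) (fun μ y' => adCLM ℝ (A' μ y'))) 0 (blockOf (L ^ K) M) (kingGT L a msq K M κ)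
      (g := unitTorusGeoS L K M Msz) (ρ := δ / 2) htri hd hrow hσ.le hσ.le (by linarith) hβ.le hη h2t le_rfl h2t hreg hregB hZ (fun _ _ => by rw [Pi.zero_apply, Pi.zero_apply, norm_zero]) hgrad hZs
      (fun _ _ => by
        have h00 := coordMat_sub e 0 0
        rw [sub_self, sub_self] at h00
        rw [Pi.zero_apply, Pi.zero_apply, h00, Matrix.transpose_zero, neg_zero]) hG hDc hq'
    refine hXc.mono fun y y' => ?_
    rw [hdist]
    exact mul_le_mul_of_nonneg_right hEle (Real.exp_nonneg _)

/-- ★★ **THE SAME ON THE FINE GRID**: the fine run `Tor (fine L (fine (L^K) M))` (`η′ = L^{−(K+1)}`), King blocks `blockOf (L^K) ∘ blockOf L`, `G′ = kingGT₁`, dressed by `e^{η′ ad A′} = Ad(e^{η′A′})` —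
size `≤ B·e^{−(δ∕2)d}` and increment `pr₀X̂′ − G′ ≤ E·t·e^{−(δ∕2)d}` with the SAME `(δ, B, E, t₀)` recipe (the constants are existential per theorem; part XXII takes maxima). [cite: Balaban1985BackgroundPropagators, (3.35) p.396, Thm 3.4 p.400, (3.63)–(3.65) pp.402–403 (mechanism); King1986, (4.1)–(4.5) p.670; Balaban1984PropagatorsI, p.25] -/
theorem uN_curvDressed_sizes_massRange_fine (he : ∀ X Y : Matrix n n ℂ, traceForm X Y = e X ⬝ᵥ e Y) (hLodd : Odd L) (hL : 2 ≤ L) {a : ℝ} (ha : 0 < a)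
    {m0sq : ℝ} (hm0 : 0 ≤ m0sq) :
    ∃ δ B E t₀ : ℝ, 0 < δ ∧ 0 < B ∧ 0 < E ∧ 0 < t₀ ∧ ∀ (K : ℕ), 1 ≤ K → ∀ (ex : ℕ) (M : Fin (d + 1) → ℕ) [∀ μ, NeZero (M μ)], (∀ μ, M μ = 2 * L ^ ex) →
      ∀ (msq : ℝ), 0 ≤ msq → msq ≤ m0sq → ∀ (Msz : ℝ) (A' : Fin (d + 1) → Tor (fine L (fine (L ^ K) M)) → Matrix n n ℂ) (t : ℝ), 0 ≤ t → t ≤ t₀ →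
      (∀ μ y', ‖A' μ y'‖ ≤ t) →
      (∀ μ ν y', ‖A' μ y' - A' μ (y' - unitVec (fine L (fine (L ^ K) M)) ν)‖ ≤ ((L : ℝ) ^ (K + 1))⁻¹ * t) →
      (∀ μ y', (A' μ y')ᴴ = -A' μ y') →
    HasMaj (BlockNorm.ofBlocks (unitTorusGeoS L K M Msz) (liftBlk (blockOf (L ^ K) M ∘ blockOf L (fine (L ^ K) M)) κ))
          (BlockNorm.ofBlocks (unitTorusGeoS L K M Msz) (liftBlk (blockOf (L ^ K) M ∘ blockOf L (fine (L ^ K) M)) κ))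
        (projO (none : Option (Fin (d + 1) ⊕ Fin (d + 1))) ∘ₗ
          curvDressed ((L : ℝ) ^ (K + 1))⁻¹ (torStep (fine L (fine (L ^ K) M))) (expTrField e ((L : ℝ) ^ (K + 1))⁻¹ 0) (expTrField e ((L : ℝ) ^ (K + 1))⁻¹ (fun μ y' => adCLM ℝ (A' μ y')))
            (kingGT₁ L a msq K M κ))
        (fun y y' => B * Real.exp (-(δ / 2 * tdistT M y y'))) ∧
      HasMaj (BlockNorm.ofBlocks (unitTorusGeoS L K M Msz) (liftBlk (blockOf (L ^ K) M ∘ blockOf L (fine (L ^ K) M)) κ))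
          (BlockNorm.ofBlocks (unitTorusGeoS L K M Msz) (liftBlk (blockOf (L ^ K) M ∘ blockOf L (fine (L ^ K) M)) κ))
        (projO (none : Option (Fin (d + 1) ⊕ Fin (d + 1))) ∘ₗ
          curvDressed ((L : ℝ) ^ (K + 1))⁻¹ (torStep (fine L (fine (L ^ K) M))) (expTrField e ((L : ℝ) ^ (K + 1))⁻¹ 0) (expTrField e ((L : ℝ) ^ (K + 1))⁻¹ (fun μ y' => adCLM ℝ (A' μ y')))
            (kingGT₁ L a msq K M κ) - kingGT₁ L a msq K M κ)
        (fun y y' => E * t * Real.exp (-(δ / 2 * tdistT M y y'))) := by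
  obtain ⟨β, δ, m, hβ, hδ, hm, H⟩ := kingFullProp_layer_backward_massRange (d := d) L hLodd hL ha hm0 (γ := 1 / 2) (by norm_num) (by norm_num) (α := 1 / 2) (by norm_num) (by norm_num)
  -- level-independent letters: `c_r`, the row slope `S`, `D = 4β(S c_d)c_r + 1`, `t₀ = min ½ (1∕(2D))`
  have hc : 0 ≤ B4Sect5Proof.latticeConst (d + 1) (δ / 2) := B4Sect5Proof.latticeConst_nonneg (d + 1) (half_pos hδ).le
  obtain ⟨S, hS_def⟩ : ∃ S : ℝ, S = Real.sqrt (Fintype.card κ) * Real.exp 1 * ((Fintype.card κ : ℝ) + (Fintype.card κ : ℝ) ^ 3) +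
      (Fintype.card κ : ℝ) * ((Fintype.card (Fin (d + 1)) : ℝ) * ((Fintype.card κ : ℝ) * (Real.sqrt (Fintype.card κ) * Real.exp 1) ^ 2 + Real.sqrt (Fintype.card κ) * Real.exp 1)) := ⟨_, rfl⟩
  have hS : 0 ≤ S := by rw [hS_def]; positivity
  obtain ⟨D, hD_def⟩ : ∃ D : ℝ, D = 4 * β * (S * (1 + Fintype.card (Fin (d + 1) ⊕ Fin (d + 1)))) * B4Sect5Proof.latticeConst (d + 1) (δ / 2) + 1 := ⟨_, rfl⟩
  have hD : 0 < D := by rw [hD_def]; positivity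
  refine ⟨δ, 2 * β, 4 * β ^ 2 * (S * (1 + Fintype.card (Fin (d + 1) ⊕ Fin (d + 1)))) * B4Sect5Proof.latticeConst (d + 1) (δ / 2) + 1, min (1 / 2) (1 / (2 * D)), hδ,
    by positivity, by positivity, lt_min (by norm_num) (by positivity), fun K hK ex M _ hM msq hmsq hcap Msz A' t ht0 htt₀ hA hgradA hAs => ?_⟩
  -- the small field: `2t ≤ 1`, the Neumann smallness, and the two constants of the conclusions (pure arithmetic)
  obtain ⟨ht1, hq', hBle, hEle⟩ := smallField_rowLetter (d := d) e he (c := B4Sect5Proof.latticeConst (d + 1) (δ / 2)) hβ hc hS_def hD_def ht0 htt₀ rfl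
  have h2t : 0 ≤ 2 * t := by positivity
  -- carrier facts of the level
  have hL1 : (1 : ℝ) ≤ (L : ℝ) := by exact_mod_cast (show 1 ≤ L by omega)
  have hL0 : (0 : ℝ) < (L : ℝ) := by positivity
  have hη' : 0 < ((L : ℝ) ^ (K + 1))⁻¹ := by positivity
  have hη : 0 < (L : ℝ) * ((L : ℝ) ^ (K + 1))⁻¹ := mul_pos hL0 hη'
  have hηle : (L : ℝ) * ((L : ℝ) ^ (K + 1))⁻¹ ≤ 1 := by
    rw [pow_succ', mul_inv, ← mul_assoc, mul_inv_cancel₀ hL0.ne', one_mul]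
    exact inv_le_one_of_one_le₀ (one_le_pow₀ hL1)
  have hη'le : ((L : ℝ) ^ (K + 1))⁻¹ ≤ 1 := inv_le_one_of_one_le₀ (one_le_pow₀ hL1)
  have hreg : (L : ℝ) * ((L : ℝ) ^ (K + 1))⁻¹ * (2 * t) ≤ 1 := by nlinarith
  have hreg' : ((L : ℝ) ^ (K + 1))⁻¹ * (2 * t) ≤ 1 := by nlinarith
  have hregB : (L : ℝ) * ((L : ℝ) ^ (K + 1))⁻¹ * 0 ≤ 1 := by simp
  have hregB' : ((L : ℝ) ^ (K + 1))⁻¹ * 0 ≤ 1 := by simp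
  have hσ : 0 < δ / 2 := half_pos hδ
  have htri : Triangle254 (unitTorusGeoS L K M Msz) := triangle254_unitTorusGeo L K M
  have hd : ∀ a b : (unitTorusGeoS L K M Msz).Site, 0 ≤ (unitTorusGeoS L K M Msz).dist a b := fun a b => tdistT_nonneg M a b
  have hrow : RowSum (unitTorusGeoS L K M Msz) (δ / 2) (B4Sect5Proof.latticeConst (d + 1) (δ / 2)) := rowSum_unitTorusGeo L K M hσ
  have hdist : ∀ y y' : Tor M, (unitTorusGeoS L K M Msz).dist y y' = tdistT M y y' := fun _ _ => rfl
  -- the nine scalar letters one level up (`n = 1`) at this mass, their majorants nonnegative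
  have HK := fun μ : Fin (d + 1) => H K hK 1 le_rfl ex M hM msq hmsq hcap Msz μ
  have maj0 : ∀ y y' : Tor M, 0 ≤ β * Real.exp (-(δ * tdistT M y y')) := fun _ _ => by positivity
  -- (hG′), (hD′) — fine, through the cast
  have hG' : HasMaj (BlockNorm.ofBlocks (unitTorusGeoS L K M Msz) (liftBlk (blockOf (L ^ K) M ∘ blockOf L (fine (L ^ K) M)) κ))
      (BlockNorm.ofBlocks (unitTorusGeoS L K M Msz) (liftBlk (blockOf (L ^ K) M ∘ blockOf L (fine (L ^ K) M)) κ)) (kingGT₁ L a msq K M κ)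
      (fun y y' => β * Real.exp (-(δ * (unitTorusGeoS L K M Msz).dist y y'))) := by
    refine hasMaj_tensorId κ maj0 ?_
    rw [blockOf_comp_blockOf_eq]
    exact hasMaj_conjEquiv _ _ (castT L K M) maj0 (HK 0).2.2.2.1
  have hDf : ∀ j, HasMaj (BlockNorm.ofBlocks (unitTorusGeoS L K M Msz) (liftBlk (blockOf (L ^ K) M ∘ blockOf L (fine (L ^ K) M)) κ))
      (BlockNorm.ofBlocks (unitTorusGeoS L K M Msz) (liftBlk (blockOf (L ^ K) M ∘ blockOf L (fine (L ^ K) M)) κ))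
      (covPieces (((L : ℝ) ^ (K + 1))⁻¹) (torStep (fine L (fine (L ^ K) M)))
        (gaugePair (torStep (fine L (fine (L ^ K) M))) (expTrField e (((L : ℝ) ^ (K + 1))⁻¹) 0)) (kingGT₁ L a msq K M κ) j)
      (fun y y' => β * Real.exp (-(δ * (unitTorusGeoS L K M Msz).dist y y'))) := by
    intro j
    rw [expTrField_zero, gaugePair_one]
    cases j with
    | inl μ =>
        rw [covPieces_flat_fine_inl]
        refine hasMaj_tensorId κ maj0 ?_
        rw [blockOf_comp_blockOf_eq]
        exact hasMaj_conjEquiv _ _ (castT L K M) maj0 (HK μ).2.2.2.2.1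
    | inr μ =>
        rw [covPieces_flat_fine_inr]
        refine hasMaj_tensorId κ maj0 ?_
        rw [blockOf_comp_blockOf_eq]
        exact hasMaj_conjEquiv _ _ (castT L K M) maj0 (HK μ).2.2.2.2.2.1
  -- generator letters READ OFF the potential: fine `Z′ = ad ∘ A′`, coarse `Z̄′` = block mean; `W = W′ = 0`
  have h2 : ∀ {X : Matrix n n ℂ} {c : ℝ}, ‖X‖ ≤ c → ‖adCLM ℝ X‖ ≤ 2 * c := fun hX => (norm_adCLM_le ℝ _).trans (mul_le_mul_of_nonneg_left hX two_pos.le)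
  have hZ' : ∀ μ y', ‖adCLM ℝ (A' μ y')‖ ≤ 2 * t := fun μ y' => h2 (hA μ y')
  have hgrad' : ∀ μ ν y', ‖adCLM ℝ (A' μ y') - adCLM ℝ (A' μ (y' - unitVec (fine L (fine (L ^ K) M)) ν))‖ ≤ ((L : ℝ) ^ (K + 1))⁻¹ * (2 * t) := fun μ ν y' => by
    rw [adCLM_sub, mul_left_comm]; exact h2 (hgradA μ ν y')
  have hgrad'τ : ∀ μ y', ‖adCLM ℝ (A' μ y') - adCLM ℝ (A' μ ((torStep (fine L (fine (L ^ K) M)) μ).symm y'))‖ ≤ ((L : ℝ) ^ (K + 1))⁻¹ * (2 * t) := fun μ y' => by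
    rw [torStep_symm_apply]; exact hgrad' μ μ y'
  have hZs' : ∀ μ y', (coordMat e (adCLM ℝ (A' μ y')))ᵀ = -coordMat e (adCLM ℝ (A' μ y')) := fun μ y' =>
    coordMat_adCLM_transpose_eq_neg_of_conjTranspose e he (hAs μ y')
  refine ⟨?_, ?_⟩
  · -- fine size
    have hXf := hasMaj_curvDressed_exp_of_skew e (((L : ℝ) ^ (K + 1))⁻¹) (torStep (fine L (fine (L ^ K) M))) (fun μ y' => adCLM ℝ (A' μ y')) 0
      (blockOf (L ^ K) M ∘ blockOf L (fine (L ^ K) M)) (kingGT₁ L a msq K M κ)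
      (g := unitTorusGeoS L K M Msz) (ρ := δ / 2) htri hd hrow hσ.le hσ.le (by linarith) hβ.le hη' h2t le_rfl h2t hreg' hregB' hZ' (fun _ _ => by rw [Pi.zero_apply, Pi.zero_apply, norm_zero]) hgrad'τ hZs'
      (fun _ _ => by
        have h00 := coordMat_sub e 0 0
        rw [sub_self, sub_self] at h00
        rw [Pi.zero_apply, Pi.zero_apply, h00, Matrix.transpose_zero, neg_zero]) hG' hDf hq'
    refine (hasMaj_projO_comp (g := unitTorusGeoS L K M Msz) (liftBlk (blockOf (L ^ K) M ∘ blockOf L (fine (L ^ K) M)) κ) hXf none).mono fun y y' => ?_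
    rw [hdist]
    exact mul_le_mul_of_nonneg_right hBle (Real.exp_nonneg _)
  · -- fine increment
    have hXf := hasMaj_curvDressed_sub_exp_of_skew e (((L : ℝ) ^ (K + 1))⁻¹) (torStep (fine L (fine (L ^ K) M))) (fun μ y' => adCLM ℝ (A' μ y')) 0
      (blockOf (L ^ K) M ∘ blockOf L (fine (L ^ K) M)) (kingGT₁ L a msq K M κ)
      (g := unitTorusGeoS L K M Msz) (ρ := δ / 2) htri hd hrow hσ.le hσ.le (by linarith) hβ.le hη' h2t le_rfl h2t hreg' hregB' hZ' (fun _ _ => by rw [Pi.zero_apply, Pi.zero_apply, norm_zero]) hgrad'τ hZs'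
      (fun _ _ => by
        have h00 := coordMat_sub e 0 0
        rw [sub_self, sub_self] at h00
        rw [Pi.zero_apply, Pi.zero_apply, h00, Matrix.transpose_zero, neg_zero]) hG' hDf hq'
    refine hXf.mono fun y y' => ?_
    rw [hdist]
    exact mul_le_mul_of_nonneg_right hEle (Real.exp_nonneg _)

end Sizes

end Summit.QuantumFields.YangMills.BalabanUVNodes.N15.SiteLayerBg

end
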